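import Summits.CriticalPhenomena.PercolationContinuityZ3.Theorems.PercNearOneGluingNoHeavyQuantTransportLight
import Summits.CriticalPhenomena.PercolationContinuityZ3.Theorems.PercNearOneGluingNoHeavyQuantDIBStarFloorSplitInductionLumpy
import Summits.CriticalPhenomena.PercolationContinuityZ3.Theorems.PercNearOneGluingNoHeavyQuantDIBStarCorner
import HarnessLib

/-!
# QUANT lane R8 — CONJECTURE DIB\* IS A THEOREM AT EVERY FLOOR `x ∈ [7/8, 1)`

builds on p205010 (kernel theorem, internal audit signed; external expert review pending)

Support file (`--supports stmt-CriticalPhenomena-4575`), QUANT lane typer seat prim-quant-stmt (gen 21); assembles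
`…QuantTransportCell` (p275739: the transport cell, largest blob heavy) and `…QuantTransportLight` (largest blob light) into
**`Quant.IndepBlob.dibStar_of_ge_seven_eighths : ∀ x, 7/8 ≤ x → x < 1 → DIBStar x`** — Conjecture DIB\* (`Quant.IndepBlob.DIBStar`,
typer g17, p258? `…QuantDIBStar`; README V185/V192/V222′: the single probabilistic ingredient of the R8 architecture of record, kernel
before this file for `x ≤ 1/2` only, `IndepBlob.DIBStar.of_le_half`) holds at every floor `x ≥ 7/8`.  Theorems only, no definitions,
no sorries, standard axioms.

PROOF.  Given an instance of `DIBWith x κ_x` (blob type `ι`, sizes `a`, gates `g ∈ [0,1]`, light sizes `≤ j`, credit `> 2j`):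
(1) ZERO OUT THE JUNK: `a₁ k = a k` if `x² ≤ g k`, else `0` — a light blob of gate `< x²` has negative credit, so the credit only grows,
and shrinking sizes lowers the tail (`RootDec.term_mono_sizes`);
(2) NORMALISE EMPTY GATES: `g₁ k = g k` if `a₁ k ≠ 0`, else `1` — the tail does not see gates of empty blobs
(`RootDec.dibSum_congr_offEmpty`), nor does the credit; now every gate is `≥ x²`;
(3) a LARGEST blob `k₀` of `a₁`: if `a₁ k₀ ≥ j + 1` it is heavy (light blobs have size `≤ j`) and alone certifies the row
(`RootDec.term_ge_disj_giants`); otherwise `RootDec.tail_ge_of_largest_of_credit` (transport cell if `x ≤ g k₀`, transport +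
Cantelli cell if `g k₀ < x`).
COROLLARIES: `DIBStarCorner x`, `DIBPsi x` at these floors; with `IndepBlob.DIBStar.of_le_half` the open floors of Conjecture DIB\*
are exactly `(1/2, 7/8)` (`dibStar_of_not_mem_Ioo`).

NOVELTY.  presearch: as for `…QuantTransportCell` — [this work]; the gluing rows served [cite: KozmaNitzan2024, Conjecture 3 (p. 15)];
product weights [cite: Grimmett1999, §1.3 p. 10].
-/

namespace Summit.CriticalPhenomena.PercolationContinuityZ3.Theorems

namespace Quant

namespace IndepBlob

open Finset

/-- **CONJECTURE DIB\* HOLDS AT EVERY FLOOR `7/8 ≤ x < 1`.** [this work] -/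
theorem dibStar_of_ge_seven_eighths (x : ℝ) (hx : 7 / 8 ≤ x) (hx1 : x < 1) : DIBStar x := by
  intro ι _ _ a g j hg hlight hcredit
  have hx0 : 0 ≤ x := by linarith
  have hy : 0 < 1 - x := by linarith
  have hx2 : x ^ 2 ≤ x := by nlinarith
  set φ : ℝ → ℝ := fun t => if x ≤ t then t else (t - x ^ 2) / (1 - x) with hφ
  -- (1) zero out the junk
  set a₁ : ι → ℕ := fun k => if x ^ 2 ≤ g k then a k else 0 with ha₁
  have ha₁le : ∀ k, a₁ k ≤ a k := fun k => by simp only [ha₁]; split_ifs <;> omega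
  have ha₁eq : ∀ k, x ^ 2 ≤ g k → a₁ k = a k := fun k hk => by simp only [ha₁, if_pos hk]
  have ha₁zero : ∀ k, g k < x ^ 2 → a₁ k = 0 := fun k hk => by simp only [ha₁, if_neg (not_le.2 hk)]
  have hcredit₁ : (2 * j : ℝ) < ∑ k, (a₁ k : ℝ) * φ (g k) := by
    refine hcredit.trans_le (Finset.sum_le_sum fun k _ => ?_)
    by_cases hk : x ^ 2 ≤ g k
    · rw [ha₁eq k hk]
    · have hgk : g k < x ^ 2 := not_le.1 hk
      have hgx : ¬ x ≤ g k := not_le.2 (hgk.trans_le hx2)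
      rw [ha₁zero k hgk, Nat.cast_zero, zero_mul]
      have hneg : φ (g k) ≤ 0 := by
        simp only [hφ, if_neg hgx]
        exact div_nonpos_of_nonpos_of_nonneg (by linarith) hy.le
      exact mul_nonpos_of_nonneg_of_nonpos (Nat.cast_nonneg _) hneg
  -- (2) normalise the gates of empty blobs
  set g₁ : ι → ℝ := fun k => if a₁ k = 0 then 1 else g k with hg₁
  have hg₁eq : ∀ k, a₁ k ≠ 0 → g₁ k = g k := fun k hk => by simp only [hg₁, if_neg hk]
  have hg₁01 : ∀ k, 0 ≤ g₁ k ∧ g₁ k ≤ 1 := fun k => by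
    by_cases hk : a₁ k = 0
    · simp only [hg₁, if_pos hk]; norm_num
    · rw [hg₁eq k hk]; exact hg k
  have hfloor₁ : ∀ k, x ^ 2 ≤ g₁ k := fun k => by
    by_cases hk : a₁ k = 0
    · simp only [hg₁, if_pos hk]; nlinarith
    · rw [hg₁eq k hk]
      by_contra hcon
      exact hk (ha₁zero k (not_le.1 hcon))
  have hcredit₂ : (2 * j : ℝ) < ∑ k, (a₁ k : ℝ) * φ (g₁ k) := by
    refine hcredit₁.trans_le (le_of_eq (Finset.sum_congr rfl fun k _ => ?_))
    by_cases hk : a₁ k = 0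
    · rw [hk, Nat.cast_zero, zero_mul, zero_mul]
    · rw [hg₁eq k hk]
  -- the tail of `(a₁, g₁)` is at most the original tail
  have htail : ∑ W : Finset ι, (∏ k, if k ∈ W then g₁ k else 1 - g₁ k) * (if j + 1 ≤ ∑ k ∈ W, a₁ k then (1 : ℝ) else 0) ≤
      ∑ W : Finset ι, (∏ k, if k ∈ W then g k else 1 - g k) * (if j + 1 ≤ ∑ k ∈ W, a k then (1 : ℝ) else 0) := by
    rw [RootDec.dibSum_congr_offEmpty a₁ g g₁ j hg₁eq]
    have h := RootDec.term_mono_sizes 0 a₁ a g j hg ha₁le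
    simpa only [zero_add] using h
  refine le_trans ?_ htail
  -- (3) a largest blob of `a₁`
  have hne : (Finset.univ : Finset ι).Nonempty := by
    rcases (Finset.univ : Finset ι).eq_empty_or_nonempty with h | h
    · exfalso
      rw [h, Finset.sum_empty] at hcredit
      have : (0 : ℝ) ≤ 2 * j := by positivity
      linarith
    · exact h
  obtain ⟨k₀, -, hk₀⟩ := Finset.exists_max_image Finset.univ a₁ hne
  have hlargest : ∀ k, a₁ k ≤ a₁ k₀ := fun k => hk₀ k (Finset.mem_univ k)
  by_cases hgiant : j + 1 ≤ a₁ k₀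
  · -- a giant of `a₁` is non-empty, hence has gate `≥ x²`; it is heavy because light blobs have size `≤ j`
    have hk₀ne : a₁ k₀ ≠ 0 := by omega
    have hheavy : x ≤ g k₀ := by
      by_contra hcon
      have := hlight k₀ (not_le.1 hcon)
      have := ha₁le k₀
      omega
    have hgk₀ : g₁ k₀ = g k₀ := hg₁eq k₀ hk₀ne
    have h := RootDec.term_ge_disj_giants 0 a₁ g₁ j hg₁01 {k₀} (fun k hk => by
      rw [Finset.mem_singleton] at hk; rw [hk]; omega)
    rw [Finset.prod_singleton, hgk₀, sub_sub_cancel] at h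
    refine hheavy.trans (h.trans (le_of_eq (Finset.sum_congr rfl fun W _ => by rw [zero_add])))
  · -- the two transport cells
    exact RootDec.tail_ge_of_largest_of_credit a₁ g₁ j x hx hx1 hg₁01 hfloor₁ k₀ hlargest (by omega) hcredit₂

/-- The corner form (`…QuantDIBStarCorner`) at these floors. [this work] -/
theorem dibStarCorner_of_ge_seven_eighths (x : ℝ) (hx : 7 / 8 ≤ x) (hx1 : x < 1) : DIBStarCorner x :=
  DIBStarCorner.of_dibStar (dibStar_of_ge_seven_eighths x hx hx1)

/-- DIB-ψ (the weaker row the tree programme needs, census-2 g49 §6.2) at these floors. [this work] -/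
theorem dibPsi_of_ge_seven_eighths (x : ℝ) (hx : 7 / 8 ≤ x) (hx1 : x < 1) : DIBPsi x :=
  dibPsi_of_dibStar hx1 (dibStar_of_ge_seven_eighths x hx hx1)

/-- **STATUS OF CONJECTURE DIB\* after this file: kernel off the open interval `(1/2, 7/8)`** — for every `x < 1` with
`x ∉ (1/2, 7/8)`, `DIBStar x` (`DIBStar.of_le_half` below `1/2`, `dibStar_of_ge_seven_eighths` from `7/8`). [this work] -/
theorem dibStar_of_not_mem_Ioo (x : ℝ) (hx1 : x < 1) (hx : x ∉ Set.Ioo (1 / 2 : ℝ) (7 / 8)) : DIBStar x := by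
  rw [Set.mem_Ioo, not_and_or, not_lt, not_lt] at hx
  rcases hx with h | h
  · exact DIBStar.of_le_half h
  · exact dibStar_of_ge_seven_eighths x h hx1

end IndepBlob

end Quant

end Summit.CriticalPhenomena.PercolationContinuityZ3.Theorems
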